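import Mathlib
import Summits.AtomisticToContinuum.Crystallization.Theses.PhononSlackCertificates
import Summits.AtomisticToContinuum.Crystallization.Theorems.PhononSlackCertificatesNearFarGlueRFill
import Summits.AtomisticToContinuum.Crystallization.Theorems.PhononSlackCertificatesNearFarGlueRMove
import Summits.AtomisticToContinuum.Crystallization.Theorems.PhononSlackCertificatesNearFarGlueRWellBonded
import Summits.AtomisticToContinuum.Crystallization.Theorems.PhononSlackCertificatesNearFarGlueRLooseReduction
import Summits.AtomisticToContinuum.Crystallization.Theorems.PhononSlackCertificatesNearFarGlueRLooseTarget
import Literature.MathematicalPhysics.StatisticalMechanics.LennardJonesClusters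

/-!
# Crux `PhononSlackCertificates.NearFarGlueR` (stmt-AtomisticToContinuum-14970), line `Sketch`:
the three monotone STEPS (strip / fill / move) of the stable-core normal form

Continuation lead c4, part 3e-i (registered sub-goal `stub_stableCoreStep`).  On a
`3/10`-separated configuration each of the three operations LOWERS the excess `𝓔(x) − N·e*` by a
fixed quantum while changing the counts `#T` (tight contacts) and `#bad` by a bounded amount, and
keeps `3/10`-separation:

* `strip_step` — STRIP the loose particles (`A_j ≥ −θ`): quantum `0.711 − θ` per particle
  (`strip_round_loose`, certified `e* ≤ −0.711`), counts `5833` / `1332` per particle;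
* `fill_step` — FILL a deep hole (`W_p ≤ −98309653/125000000 − g`, `p` at distance `≥ 3/10` from
  everything): quantum `g` (`fill_energy`, certified two-cone floor `e* ≥ −0.7865`), counts
  `5833` / `1332`;
* `move_step` — MOVE one particle to a site at distance `≥ 3/10` from the others where it binds
  more strongly by `g'`: quantum `g'` (`move_energy`, pure move principle), counts `11664` / `2662`;
* `stableCore_step` — a configuration that is not a stable core (well-bonded ∧ hole-free ∧
  move-stable) admits one of them, with quantum `≥ min(0.711 − θ, g, g')`.

Part 3e-ii (`…NearFarGlueRStableCore`) iterates the step down to a stable core.  All `[folklore]`.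
-/

noncomputable section

namespace Summit.AtomisticToContinuum.Crystallization.Theorems.PhononSlackCertificatesNearFarGlueR

open Literature.MathematicalPhysics.StatisticalMechanics
open Literature.Geometry.DiscreteGeometry
open Summit.AtomisticToContinuum.Crystallization.Theses.PhononSlackCertificates
open Summit.AtomisticToContinuum.Crystallization.Theorems.ChargedEnergyGapNegative
  (eStar card_mul_eStar_le)
open scoped BigOperators

/-! ## §1 The three steps -/

/-- **Strip step.**  If some particle of the `3/10`-separated `x` is loose (`A_j ≥ −θ`), stripping
all loose particles gives a `3/10`-separated `y` with `[𝓔(y) − N'·e*] + (0.711 − θ)·w ≤ 𝓔(x) − N·e*`,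
`#T(x) ≤ #T(y) + 5833·w`, `#bad(x) ≤ #bad(y) + 1332·w`, `w ≥ 1` the number of stripped particles.
[folklore] -/
theorem strip_step {θ : ℝ} {N : ℕ} (x : Fin N → EuclideanSpace ℝ (Fin 3))
    (hsep : (∀ i j : Fin N, i ≠ j → (3 / 10 : ℝ) ≤ dist (x i) (x j)))
    (hwb : ¬ (∀ j : Fin N, ∑ k ∈ Finset.univ.erase j,
        (min (lennardJones (dist (x j) (x k))) 0 +
          (1 / 2 : ℝ) * max (lennardJones (dist (x j) (x k))) 0) < -θ)) :
    ∃ (N' : ℕ) (y : Fin N' → EuclideanSpace ℝ (Fin 3)) (w : ℕ), 1 ≤ w ∧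
      (∀ i j : Fin N', i ≠ j → (3 / 10 : ℝ) ≤ dist (y i) (y j)) ∧
      interactionEnergy lennardJones y -
          (N' : ℝ) * (⨅ Q : PeriodicConfiguration 3, Q.energyPerParticle lennardJones) + (711 / 1000 - θ) * w ≤
        interactionEnergy lennardJones x -
          (N : ℝ) * (⨅ Q : PeriodicConfiguration 3, Q.energyPerParticle lennardJones) ∧
      (Nat.card {j : Fin N // ¬ IsTwoShellGood (1 / 20) (47 / 50) 1 x j ∧
            ∃ i : Fin N, IsTwoShellGood (1 / 20) (47 / 50) 1 x i ∧ dist (x i) (x j) ≤ 21 / 20} : ℝ) ≤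
        (Nat.card {j : Fin N' // ¬ IsTwoShellGood (1 / 20) (47 / 50) 1 y j ∧
            ∃ i : Fin N', IsTwoShellGood (1 / 20) (47 / 50) 1 y i ∧ dist (y i) (y j) ≤ 21 / 20} : ℝ) + 5833 * w ∧
      (Nat.card {j : Fin N // ¬ IsTwoShellGood (1 / 20) (47 / 50) 1 x j} : ℝ) ≤ (Nat.card {j : Fin N' // ¬ IsTwoShellGood (1 / 20) (47 / 50) 1 y j} : ℝ) + 1332 * w := by
  classical
  have hx : Function.Injective x := fibre_injective_of_separated (by norm_num) hsep
  set W := Finset.univ.filter fun j : Fin N => -θ ≤ ∑ k ∈ Finset.univ.erase j,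
    (min (lennardJones (dist (x j) (x k))) 0 +
      (1 / 2 : ℝ) * max (lennardJones (dist (x j) (x k))) 0) with hW
  have hWne : W.Nonempty := by
    push Not at hwb
    obtain ⟨j, hj⟩ := hwb
    exact ⟨j, Finset.mem_filter.2 ⟨Finset.mem_univ _, hj⟩⟩
  have hWpos : 1 ≤ W.card := Finset.card_pos.2 hWne
  set f₀ := (Wᶜ).orderEmbOfFin rfl with hf₀
  have hmap : Finset.univ.map f₀.toEmbedding = Wᶜ := Finset.map_orderEmbOfFin_univ Wᶜ rfl
  set y := x ∘ f₀.toEmbedding with hy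
  have hysep : ∀ k l : Fin (Wᶜ.card), k ≠ l → (3 / 10 : ℝ) ≤ dist (y k) (y l) :=
    fun k l hkl => hsep _ _ fun h => hkl (f₀.toEmbedding.injective h)
  have hround := strip_round_loose x W f₀.toEmbedding hmap θ
    (fun j hj => (Finset.mem_filter.1 hj).2)
  have hK : ((Wᶜ.card : ℕ) : ℝ) = (N : ℝ) - (W.card : ℝ) := by
    rw [Finset.card_compl, Fintype.card_fin, Nat.cast_sub (by simpa using W.card_le_univ)]
  have hT := card_contact_le_strip x f₀.toEmbedding hysep
  have hB := card_bad_le_strip x f₀.toEmbedding hysep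
  rw [hK] at hT hB
  refine ⟨Wᶜ.card, y, W.card, hWpos, hysep, ?_, ?_, ?_⟩
  · have hyE : interactionEnergy lennardJones y -
        ((Wᶜ.card : ℕ) : ℝ) * (⨅ Q : PeriodicConfiguration 3,
          Q.energyPerParticle lennardJones) + (711 / 1000 - θ) * (W.card : ℝ) ≤
        interactionEnergy lennardJones x -
          (N : ℝ) * (⨅ Q : PeriodicConfiguration 3, Q.energyPerParticle lennardJones) := hround
    exact hyE
  · have hT' : (Nat.card {j : Fin N // ¬ IsTwoShellGood (1 / 20) (47 / 50) 1 x j ∧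
            ∃ i : Fin N, IsTwoShellGood (1 / 20) (47 / 50) 1 x i ∧ dist (x i) (x j) ≤ 21 / 20} : ℝ) ≤
        5833 * (W.card : ℝ) +
        (Nat.card {j : Fin (Wᶜ.card) // ¬ IsTwoShellGood (1 / 20) (47 / 50) 1 y j ∧
            ∃ i : Fin (Wᶜ.card), IsTwoShellGood (1 / 20) (47 / 50) 1 y i ∧ dist (y i) (y j) ≤ 21 / 20} : ℝ) := by
      have := hT; simp only [hy] at this ⊢; linarith
    linarith [hT']
  · have hB' : (Nat.card {j : Fin N // ¬ IsTwoShellGood (1 / 20) (47 / 50) 1 x j} : ℝ) ≤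
        1332 * (W.card : ℝ) + (Nat.card {j : Fin (Wᶜ.card) // ¬ IsTwoShellGood (1 / 20) (47 / 50) 1 y j} : ℝ) := by
      have := hB; simp only [hy] at this ⊢; linarith
    linarith [hB']

/-- **Fill step.**  If the `3/10`-separated `x` has a deep hole, filling it gives a
`3/10`-separated `y` (one more particle) with `[𝓔(y) − N'·e*] + g ≤ 𝓔(x) − N·e*`,
`#T(x) ≤ #T(y) + 5833`, `#bad(x) ≤ #bad(y) + 1332`. [folklore] -/
theorem fill_step {g : ℝ} {N : ℕ} (x : Fin N → EuclideanSpace ℝ (Fin 3))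
    (hsep : (∀ i j : Fin N, i ≠ j → (3 / 10 : ℝ) ≤ dist (x i) (x j)))
    (hhf : ¬ (∀ p : EuclideanSpace ℝ (Fin 3), (∀ i : Fin N, (3 / 10 : ℝ) ≤ dist p (x i)) →
        -(98309653 / 125000000 : ℝ) - g < ∑ i, lennardJones (dist p (x i)))) :
    ∃ (N' : ℕ) (y : Fin N' → EuclideanSpace ℝ (Fin 3)) (w : ℕ), 1 ≤ w ∧
      (∀ i j : Fin N', i ≠ j → (3 / 10 : ℝ) ≤ dist (y i) (y j)) ∧
      interactionEnergy lennardJones y -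
          (N' : ℝ) * (⨅ Q : PeriodicConfiguration 3, Q.energyPerParticle lennardJones) + g * w ≤
        interactionEnergy lennardJones x -
          (N : ℝ) * (⨅ Q : PeriodicConfiguration 3, Q.energyPerParticle lennardJones) ∧
      (Nat.card {j : Fin N // ¬ IsTwoShellGood (1 / 20) (47 / 50) 1 x j ∧
            ∃ i : Fin N, IsTwoShellGood (1 / 20) (47 / 50) 1 x i ∧ dist (x i) (x j) ≤ 21 / 20} : ℝ) ≤
        (Nat.card {j : Fin N' // ¬ IsTwoShellGood (1 / 20) (47 / 50) 1 y j ∧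
            ∃ i : Fin N', IsTwoShellGood (1 / 20) (47 / 50) 1 y i ∧ dist (y i) (y j) ≤ 21 / 20} : ℝ) + 5833 * w ∧
      (Nat.card {j : Fin N // ¬ IsTwoShellGood (1 / 20) (47 / 50) 1 x j} : ℝ) ≤ (Nat.card {j : Fin N' // ¬ IsTwoShellGood (1 / 20) (47 / 50) 1 y j} : ℝ) + 1332 * w := by
  classical
  push Not at hhf
  obtain ⟨p, hp, hWp⟩ := hhf
  set y := Fin.append x (fun _ : Fin 1 => p) with hy
  have hysep := fill_sep x hsep p hp
  have hEy := fill_energy x p hWp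
  have hT := card_contact_le_fill x hsep p
  have hB := card_bad_le_fill x hsep p
  refine ⟨N + 1, y, 1, le_rfl, hysep, ?_, ?_, ?_⟩
  · push_cast
    simp only [mul_one]
    exact hEy
  · have hT' : (Nat.card {j : Fin N // ¬ IsTwoShellGood (1 / 20) (47 / 50) 1 x j ∧
            ∃ i : Fin N, IsTwoShellGood (1 / 20) (47 / 50) 1 x i ∧ dist (x i) (x j) ≤ 21 / 20} : ℝ) ≤
        5833 + (Nat.card {j : Fin (N + 1) // ¬ IsTwoShellGood (1 / 20) (47 / 50) 1 y j ∧
            ∃ i : Fin (N + 1), IsTwoShellGood (1 / 20) (47 / 50) 1 y i ∧ dist (y i) (y j) ≤ 21 / 20} : ℝ) := hT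
    push_cast
    linarith [hT']
  · have hB' : (Nat.card {j : Fin N // ¬ IsTwoShellGood (1 / 20) (47 / 50) 1 x j} : ℝ) ≤
        1332 + (Nat.card {j : Fin (N + 1) // ¬ IsTwoShellGood (1 / 20) (47 / 50) 1 y j} : ℝ) := hB
    push_cast
    linarith [hB']

/-- **Move step.**  If some particle of the `3/10`-separated `x` gains `g'` by a single relocation
to a site at distance `≥ 3/10` from the others, the move gives a `3/10`-separated `y` with
`[𝓔(y) − N·e*] + g' ≤ 𝓔(x) − N·e*`, `#T(x) ≤ #T(y) + 11664`, `#bad(x) ≤ #bad(y) + 2662`.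
[folklore] -/
theorem move_step {g' : ℝ} {N : ℕ} (x : Fin N → EuclideanSpace ℝ (Fin 3))
    (hsep : (∀ i j : Fin N, i ≠ j → (3 / 10 : ℝ) ≤ dist (x i) (x j)))
    (hms : ¬ (∀ (j : Fin N) (p : EuclideanSpace ℝ (Fin 3)),
        (∀ k : Fin N, k ≠ j → (3 / 10 : ℝ) ≤ dist p (x k)) →
        ∑ k ∈ Finset.univ.erase j, lennardJones (dist (x j) (x k)) - g' <
          ∑ k ∈ Finset.univ.erase j, lennardJones (dist p (x k)))) :
    ∃ (N' : ℕ) (y : Fin N' → EuclideanSpace ℝ (Fin 3)) (w : ℕ), 1 ≤ w ∧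
      (∀ i j : Fin N', i ≠ j → (3 / 10 : ℝ) ≤ dist (y i) (y j)) ∧
      interactionEnergy lennardJones y -
          (N' : ℝ) * (⨅ Q : PeriodicConfiguration 3, Q.energyPerParticle lennardJones) + g' * w ≤
        interactionEnergy lennardJones x -
          (N : ℝ) * (⨅ Q : PeriodicConfiguration 3, Q.energyPerParticle lennardJones) ∧
      (Nat.card {j : Fin N // ¬ IsTwoShellGood (1 / 20) (47 / 50) 1 x j ∧
            ∃ i : Fin N, IsTwoShellGood (1 / 20) (47 / 50) 1 x i ∧ dist (x i) (x j) ≤ 21 / 20} : ℝ) ≤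
        (Nat.card {j : Fin N' // ¬ IsTwoShellGood (1 / 20) (47 / 50) 1 y j ∧
            ∃ i : Fin N', IsTwoShellGood (1 / 20) (47 / 50) 1 y i ∧ dist (y i) (y j) ≤ 21 / 20} : ℝ) + 11664 * w ∧
      (Nat.card {j : Fin N // ¬ IsTwoShellGood (1 / 20) (47 / 50) 1 x j} : ℝ) ≤ (Nat.card {j : Fin N' // ¬ IsTwoShellGood (1 / 20) (47 / 50) 1 y j} : ℝ) + 2662 * w := by
  classical
  push Not at hms
  obtain ⟨j, p, hp, hgain⟩ := hms
  set y := Function.update x j p with hy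
  have hysep := move_sep x hsep j p hp
  have hEy := move_energy x j p hgain
  have hT := card_contact_le_move x hsep j p
  have hB := card_bad_le_move x hsep j p
  refine ⟨N, y, 1, le_rfl, hysep, ?_, ?_, ?_⟩
  · push_cast
    simp only [mul_one]
    exact hEy
  · have hT' : (Nat.card {j : Fin N // ¬ IsTwoShellGood (1 / 20) (47 / 50) 1 x j ∧
            ∃ i : Fin N, IsTwoShellGood (1 / 20) (47 / 50) 1 x i ∧ dist (x i) (x j) ≤ 21 / 20} : ℝ) ≤
        11664 + (Nat.card {j : Fin N // ¬ IsTwoShellGood (1 / 20) (47 / 50) 1 y j ∧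
            ∃ i : Fin N, IsTwoShellGood (1 / 20) (47 / 50) 1 y i ∧ dist (y i) (y j) ≤ 21 / 20} : ℝ) := by
      have := hT; simp only [hy] at this ⊢; linarith
    push_cast
    linarith [hT']
  · have hB' : (Nat.card {j : Fin N // ¬ IsTwoShellGood (1 / 20) (47 / 50) 1 x j} : ℝ) ≤
        2662 + (Nat.card {j : Fin N // ¬ IsTwoShellGood (1 / 20) (47 / 50) 1 y j} : ℝ) := by
      have := hB; simp only [hy] at this ⊢; linarith
    push_cast
    linarith [hB']

/-- **One step.**  A `3/10`-separated configuration that is not a stable core admits one of the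
three operations, with quantum `≥ min(0.711 − θ, g, g')` and count changes `≤ 11664` / `2662` per
unit. [folklore] -/
theorem stableCore_step {θ g g' : ℝ} {N : ℕ}
    (x : Fin N → EuclideanSpace ℝ (Fin 3)) (hsep : (∀ i j : Fin N, i ≠ j → (3 / 10 : ℝ) ≤ dist (x i) (x j)))
    (hnot : ¬ ((∀ j : Fin N, ∑ k ∈ Finset.univ.erase j,
        (min (lennardJones (dist (x j) (x k))) 0 +
          (1 / 2 : ℝ) * max (lennardJones (dist (x j) (x k))) 0) < -θ) ∧
      (∀ p : EuclideanSpace ℝ (Fin 3), (∀ i : Fin N, (3 / 10 : ℝ) ≤ dist p (x i)) →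
        -(98309653 / 125000000 : ℝ) - g < ∑ i, lennardJones (dist p (x i))) ∧
      (∀ (j : Fin N) (p : EuclideanSpace ℝ (Fin 3)),
        (∀ k : Fin N, k ≠ j → (3 / 10 : ℝ) ≤ dist p (x k)) →
        ∑ k ∈ Finset.univ.erase j, lennardJones (dist (x j) (x k)) - g' <
          ∑ k ∈ Finset.univ.erase j, lennardJones (dist p (x k))))) :
    ∃ (N' : ℕ) (y : Fin N' → EuclideanSpace ℝ (Fin 3)) (w : ℕ), 1 ≤ w ∧
      (∀ i j : Fin N', i ≠ j → (3 / 10 : ℝ) ≤ dist (y i) (y j)) ∧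
      interactionEnergy lennardJones y -
          (N' : ℝ) * (⨅ Q : PeriodicConfiguration 3, Q.energyPerParticle lennardJones) + min (min (711 / 1000 - θ) g) g' * w ≤
        interactionEnergy lennardJones x -
          (N : ℝ) * (⨅ Q : PeriodicConfiguration 3, Q.energyPerParticle lennardJones) ∧
      (Nat.card {j : Fin N // ¬ IsTwoShellGood (1 / 20) (47 / 50) 1 x j ∧
            ∃ i : Fin N, IsTwoShellGood (1 / 20) (47 / 50) 1 x i ∧ dist (x i) (x j) ≤ 21 / 20} : ℝ) ≤
        (Nat.card {j : Fin N' // ¬ IsTwoShellGood (1 / 20) (47 / 50) 1 y j ∧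
            ∃ i : Fin N', IsTwoShellGood (1 / 20) (47 / 50) 1 y i ∧ dist (y i) (y j) ≤ 21 / 20} : ℝ) + 11664 * w ∧
      (Nat.card {j : Fin N // ¬ IsTwoShellGood (1 / 20) (47 / 50) 1 x j} : ℝ) ≤ (Nat.card {j : Fin N' // ¬ IsTwoShellGood (1 / 20) (47 / 50) 1 y j} : ℝ) + 2662 * w := by
  set c : ℝ := min (min (711 / 1000 - θ) g) g' with hc
  have hcθ : c ≤ 711 / 1000 - θ := (min_le_left _ _).trans (min_le_left _ _)
  have hcg : c ≤ g := (min_le_left _ _).trans (min_le_right _ _)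
  have hcg' : c ≤ g' := min_le_right _ _
  by_cases hwb : (∀ j : Fin N, ∑ k ∈ Finset.univ.erase j,
        (min (lennardJones (dist (x j) (x k))) 0 +
          (1 / 2 : ℝ) * max (lennardJones (dist (x j) (x k))) 0) < -θ)
  · by_cases hhf : (∀ p : EuclideanSpace ℝ (Fin 3), (∀ i : Fin N, (3 / 10 : ℝ) ≤ dist p (x i)) →
        -(98309653 / 125000000 : ℝ) - g < ∑ i, lennardJones (dist p (x i)))
    · have hms : ¬ (∀ (j : Fin N) (p : EuclideanSpace ℝ (Fin 3)),
        (∀ k : Fin N, k ≠ j → (3 / 10 : ℝ) ≤ dist p (x k)) →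
        ∑ k ∈ Finset.univ.erase j, lennardJones (dist (x j) (x k)) - g' <
          ∑ k ∈ Finset.univ.erase j, lennardJones (dist p (x k))) := fun h => hnot ⟨hwb, hhf, h⟩
      obtain ⟨N', y, w, hw, hysep, hE, hT, hB⟩ := move_step x hsep hms
      refine ⟨N', y, w, hw, hysep, ?_, hT, hB⟩
      have hw0 : (0 : ℝ) ≤ w := Nat.cast_nonneg _
      nlinarith [hE, mul_le_mul_of_nonneg_right hcg' hw0]
    · obtain ⟨N', y, w, hw, hysep, hE, hT, hB⟩ := fill_step x hsep hhf
      have hw0 : (0 : ℝ) ≤ w := Nat.cast_nonneg _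
      refine ⟨N', y, w, hw, hysep, ?_, ?_, ?_⟩
      · nlinarith [hE, mul_le_mul_of_nonneg_right hcg hw0]
      · linarith [hT]
      · linarith [hB]
  · obtain ⟨N', y, w, hw, hysep, hE, hT, hB⟩ := strip_step x hsep hwb
    have hw0 : (0 : ℝ) ≤ w := Nat.cast_nonneg _
    refine ⟨N', y, w, hw, hysep, ?_, ?_, ?_⟩
    · nlinarith [hE, mul_le_mul_of_nonneg_right hcθ hw0]
    · linarith [hT]
    · linarith [hB]


/-- **Registered sub-goal `stub_stableCoreStep` of the crux item** (skeleton `Lines/Sketch.lean`,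
c4): a `3/10`-separated configuration that is not a stable core admits one excess-lowering step —
the statement of `stableCore_step` in closed form. [folklore] -/
theorem stub_stableCoreStep :
    ∀ (θ g g' : ℝ) (N : ℕ) (x : Fin N → EuclideanSpace ℝ (Fin 3)),
      (∀ i j : Fin N, i ≠ j → (3 / 10 : ℝ) ≤ dist (x i) (x j)) →
      ¬ ((∀ j : Fin N, ∑ k ∈ Finset.univ.erase j,
        (min (lennardJones (dist (x j) (x k))) 0 +
          (1 / 2 : ℝ) * max (lennardJones (dist (x j) (x k))) 0) < -θ) ∧
      (∀ p : EuclideanSpace ℝ (Fin 3), (∀ i : Fin N, (3 / 10 : ℝ) ≤ dist p (x i)) →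
        -(98309653 / 125000000 : ℝ) - g < ∑ i, lennardJones (dist p (x i))) ∧
      (∀ (j : Fin N) (p : EuclideanSpace ℝ (Fin 3)),
        (∀ k : Fin N, k ≠ j → (3 / 10 : ℝ) ≤ dist p (x k)) →
        ∑ k ∈ Finset.univ.erase j, lennardJones (dist (x j) (x k)) - g' <
          ∑ k ∈ Finset.univ.erase j, lennardJones (dist p (x k)))) →
    ∃ (N' : ℕ) (y : Fin N' → EuclideanSpace ℝ (Fin 3)) (w : ℕ), 1 ≤ w ∧
      (∀ i j : Fin N', i ≠ j → (3 / 10 : ℝ) ≤ dist (y i) (y j)) ∧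
      interactionEnergy lennardJones y -
          (N' : ℝ) * (⨅ Q : PeriodicConfiguration 3, Q.energyPerParticle lennardJones) + min (min (711 / 1000 - θ) g) g' * w ≤
        interactionEnergy lennardJones x -
          (N : ℝ) * (⨅ Q : PeriodicConfiguration 3, Q.energyPerParticle lennardJones) ∧
      (Nat.card {j : Fin N // ¬ IsTwoShellGood (1 / 20) (47 / 50) 1 x j ∧
            ∃ i : Fin N, IsTwoShellGood (1 / 20) (47 / 50) 1 x i ∧ dist (x i) (x j) ≤ 21 / 20} : ℝ) ≤
        (Nat.card {j : Fin N' // ¬ IsTwoShellGood (1 / 20) (47 / 50) 1 y j ∧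
            ∃ i : Fin N', IsTwoShellGood (1 / 20) (47 / 50) 1 y i ∧ dist (y i) (y j) ≤ 21 / 20} : ℝ) + 11664 * w ∧
      (Nat.card {j : Fin N // ¬ IsTwoShellGood (1 / 20) (47 / 50) 1 x j} : ℝ) ≤ (Nat.card {j : Fin N' // ¬ IsTwoShellGood (1 / 20) (47 / 50) 1 y j} : ℝ) + 2662 * w :=
  fun _ _ _ _ x hsep hnot => stableCore_step x hsep hnot

end Summit.AtomisticToContinuum.Crystallization.Theorems.PhononSlackCertificatesNearFarGlueR

end
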